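import Summits.QuantumFields.YangMills.Theorems.UnitScaleTiltFluctuationComparisonRegPrGlobalSlackCanonicalChiIntLV4
import Summits.QuantumFields.YangMills.Theorems.UnitScaleTiltFluctuationComparisonRegPrGlobalSlackKernelLegChiV4
import Summits.QuantumFields.YangMills.Theorems.UnitScaleTiltFluctuationComparisonRegPrIntLT8OfV7Leaves
import Summits.QuantumFields.YangMills.Theorems.UnitScaleTiltFluctuationComparisonRegPrAnsatzTStub
import HarnessLib

/-!
# `UnitScaleTiltFluctuationComparisonRegPrGlobalSlackCanonicalChiIntLLeavesV4` — THE v4 TWIN (★★OWNER RULING g26-№14 (F-2b); P22b trunk 11, width seat ym-ust-20520-w2 g4; skeleton v5kD) of `…ChiIntLLeaves` — WHAT THE DECIDING CRUX `FluctuationComparisonRegPrIntL` NOW IS, BY NAME: «19200's two printed leaves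
# (V2′ halving step, V3 Prop. 7) ∧ the re-typed (α) record 2′χ ∧ the K1a rows at the χ-record's canonical polymerisation (chart rows on print's χ for `L < 7`; leg currency or chart
# rows for `L ≥ 7`) ⟹ FluctuationComparisonRegPrIntL», STUB 1 and T8 discharged by name (crux stmt-QuantumFields-20520, skeleton v5kC (OWNER C3); width-lever lane B «(R1) print's
# χ of [Balaban1985UV3] (47) back», seat ym-ust-19935-r1 g4)

ONE composition of landed theorems, no hypothesis restated: `InteriorExcision.regPrIntL_of_v4ChiRecord_k1aChartRowsChiV4` (`…CanonicalChiIntL`: v5kC §2 with both analytic χ-stubs read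
from the chart rows) with STUB 1 := `ApproxLift.AnsatzT.stub_oneStepSmallLift` (p490827, closed in the tree), T8 := `thm1In8GlobalMin_of_v7Leaves hV2 hV3` (`…IntLT8OfV7Leaves`: the
two open leaves of `MinimiserStabilityRegPr`'s v7), and — in the leg-currency form — 3⁗χ's chart rows from `GlobalSlackKernelLeg.K1aLegRowsRChiV4` through
`k1aChartRowsCChiV4_of_legRowsTChiV4 ∘ k1aLegRowsTChiV4_of_GChiV4 ∘ k1aLegRowsGChiV4_of_RChiV4` (`…KernelLegChi`).

* **`regPrIntL_of_v7Leaves_recChiV4_k1aChartRowsChiV4`** : V2′ → V3 → 2′χ → (∀ odd `L ≥ 7`: `K1aChartRowsKChiV4`) → (∀ odd `1 < L < 7`, ∀ μ: `K1aChartRowsOnChiChiV4`) → `FluctuationComparisonRegPrIntL`;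
* **`regPrIntL_of_v7Leaves_recChiV4_k1aLegRowsRChiV4`** : the same with the `L ≥ 7` rows in print's leg currency (43)×(44) (`K1aLegRowsRChiV4`).
HONEST FRAMING: this is bookkeeping — the remaining hypotheses ARE the analytic content (Prop. 7 / the Sect. F halving step of [Balaban1985Variational]; the (α) record with print's
lower row; the unprinted K1a two-run kernel comparison and the (43)/(44)/(M1) displays); nothing of it is asserted, no numerics, registry untouched (`--supports stmt-QuantumFields-20520`).

References: T. Bałaban, CMP 102 (1985) 255–275 [Balaban1985UV3] ((41) p.266, (43)–(47) pp.266–267, (57) p.270, Thm 2 p.272); CMP 102 (1985) 277–309 [Balaban1985Variational] (Thm 1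
(8) p.279, Prop. 7 p.299, Prop. 8 p.304); C. King, CMP 102 (1986) 649–677 [King1986] (Thm 3.4 (3.9) p.656, Prop. 3.6 p.662); T. Bałaban, CMP 109 (1987) 249–301 [Balaban1987RG1]
((0.4) p.253).
-/

set_option autoImplicit false

noncomputable section

namespace Summit.QuantumFields.YangMills.Theorems.InteriorExcision

open Literature.MathematicalPhysics.QuantumFieldTheory.Balaban1983to89
open Literature.MathematicalPhysics.QuantumFieldTheory.Balaban1983to89.T3ContinuumYM3Torus
open Literature.MathematicalPhysics.QuantumFieldTheory.Balaban1983to89.T3InteriorExcision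
open Literature.MathematicalPhysics.QuantumFieldTheory.Balaban1983to89.T3Thm1Carrier (famX Idx)
open Summit.QuantumFields.Balaban3D.Carriers
open Summit.QuantumFields.Balaban3D.Proofs.Primitives
open Summit.QuantumFields.YangMills.Theorems.GlobalSlackCanonicalPolymers (K1aChartRowsKChiV4)
open Summit.QuantumFields.YangMills.Theorems.GlobalSlackCanonicalOnChi (K1aChartRowsOnChiChiV4)
open Summit.QuantumFields.YangMills.Theorems.GlobalSlackKernelLeg (K1aLegRowsRChiV4 k1aChartRowsCChiV4_of_legRowsTChiV4 k1aLegRowsTChiV4_of_GChiV4 k1aLegRowsGChiV4_of_RChiV4)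

/-- **THE DECIDING CRUX FROM 19200's TWO LEAVES, THE χ-RECORD AND THE χ-CHART ROWS**: V2′ (`stub_halvingStep` text), V3 (`stub_prop7From14` text), 2′χ (`AlphaInputsT3ACv4RecChi L` for
every odd `L > 1`), the six K1a chart rows at the χ-record's canonical polymerisation at the record's decay rate for every odd `L ≥ 7` (`K1aChartRowsKChiV4`), and the same with the three
configuration rows on print's χ for every odd `1 < L < 7` and every margin (`K1aChartRowsOnChiChiV4`) give `FluctuationComparisonRegPrIntL` — STUB 1 by `ApproxLift.AnsatzT.stub_oneStepSmallLift`,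
T8 by `thm1In8GlobalMin_of_v7Leaves`. [cite: Balaban1985UV3, (41) p.266, (43)-(47) pp.266-267, Thm 2 p.272; Balaban1985Variational, Thm 1 (8) p.279, Prop. 7 p.299, Prop. 8 p.304; King1986, Thm 3.4 (3.9) p.656; Balaban1987RG1, (0.4) p.253] -/
theorem regPrIntL_of_v7Leaves_recChiV4_k1aChartRowsChiV4
    (hV2 : ∀ (L : ℕ), 1 < L → ∃ B₃ : ℝ, 4 < B₃ ∧ ∃ a₅ : ℝ, 0 < a₅ ∧
      ∀ (i : Idx L) (ε₀ ε₁ : ℝ), 0 < ε₁ → ∀ (V : (famX L i).Bdry) (U : (famX L i).Cfg), (famX L i).Reg7 ε₁ V → (famX L i).InU ε₀ U →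
        (famX L i).InB V U → (famX L i).IsCritical V U → ε₀ ≤ a₅ → (famX L i).InU (max (B₃ * ε₁) (ε₀ / 2)) U)
    (hV3 : ∀ (L : ℕ), 1 < L → ∀ B₃ : ℝ, 4 < B₃ →
      ∃ a₀ a₁' O₁ : ℝ, 0 < a₀ ∧ 0 < a₁' ∧ 1 ≤ O₁ ∧ ∀ (i : Idx L) (ε₀ ε₁ : ℝ), 0 < ε₁ → ∀ V : (famX L i).Bdry, (famX L i).Reg7 ε₁ V →
        ∀ U₀ : (famX L i).Cfg, (famX L i).InU ((L : ℝ) ^ 3 * B₃ * ε₁) U₀ → (famX L i).InB V U₀ →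
          (ε₀ ≤ a₀ → B₃ * ε₁ ≤ ε₀ → (famX L i).AtMostOneCriticalOrbit ε₀ V) ∧
          (ε₁ ≤ a₁' → ∃ U : (famX L i).Cfg, (famX L i).OnMinimalOrbit (O₁ * (L : ℝ) ^ 3 * B₃ * ε₁) V U))
    (h2 : ∀ L : ℕ, Odd L → 1 < L → Summit.QuantumFields.YangMills.Theorems.AlphaInputsT3ACv4RecChi L)
    (h3 : ∀ (L : ℕ), Odd L → 7 ≤ L → ∀ (𝔠 : AlphaConsts L (suGroupModel 2).N) (a₀ a₁ : ℝ), 0 < a₀ → 0 < a₁ → 𝔠.B₃ * a₁ ≤ a₀ →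
      ∃ a : ℝ, 0 < a ∧ a < 1 ∧ K1aChartRowsKChiV4 L 𝔠 a₀ a₁ a)
    (hI : ∀ (L : ℕ), Odd L → 1 < L → L < 7 → ∀ (μ : ℝ), 0 < μ → μ < 1 → ∀ (𝔠 : AlphaConsts L (suGroupModel 2).N) (a₀ a₁ : ℝ),
      0 < a₀ → 0 < a₁ → 𝔠.B₃ * a₁ ≤ a₀ → ∃ a : ℝ, 0 < a ∧ a < 1 ∧ K1aChartRowsOnChiChiV4 L μ 𝔠 a₀ a₁ a) :
    FluctuationComparisonRegPrIntL :=
  regPrIntL_of_v4ChiRecord_k1aChartRowsChiV4 Summit.QuantumFields.YangMills.Theorems.ApproxLift.AnsatzT.stub_oneStepSmallLift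
    (thm1In8GlobalMin_of_v7Leaves hV2 hV3) h2 h3 hI

/-- **THE SAME WITH THE `L ≥ 7` ROWS IN PRINT'S LEG CURRENCY (43)×(44)**: five leg rows over `(Φ, e, B)` at the canonical leg distance (`K1aLegRowsRChiV4`) in place of `K1aChartRowsKChiV4`
(`k1aChartRowsCChiV4_of_legRowsTChiV4 ∘ k1aLegRowsTChiV4_of_GChiV4 ∘ k1aLegRowsGChiV4_of_RChiV4`, then `GlobalSlackCanonicalPolymers.globalTwoRunSlackFamChiV4_of_k1aChartRowsCChiV4`).
[cite: Balaban1985UV3, (43)-(47) pp.266-267, (57) p.270; Balaban1985Variational, Thm 1 (8) p.279, Prop. 7 p.299, Prop. 8 p.304; King1986, Thm 3.4 (3.9) p.656, Prop. 3.6 p.662; Balaban1987RG1, (0.4) p.253] -/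
theorem regPrIntL_of_v7Leaves_recChiV4_k1aLegRowsRChiV4
    (hV2 : ∀ (L : ℕ), 1 < L → ∃ B₃ : ℝ, 4 < B₃ ∧ ∃ a₅ : ℝ, 0 < a₅ ∧
      ∀ (i : Idx L) (ε₀ ε₁ : ℝ), 0 < ε₁ → ∀ (V : (famX L i).Bdry) (U : (famX L i).Cfg), (famX L i).Reg7 ε₁ V → (famX L i).InU ε₀ U →
        (famX L i).InB V U → (famX L i).IsCritical V U → ε₀ ≤ a₅ → (famX L i).InU (max (B₃ * ε₁) (ε₀ / 2)) U)
    (hV3 : ∀ (L : ℕ), 1 < L → ∀ B₃ : ℝ, 4 < B₃ →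
      ∃ a₀ a₁' O₁ : ℝ, 0 < a₀ ∧ 0 < a₁' ∧ 1 ≤ O₁ ∧ ∀ (i : Idx L) (ε₀ ε₁ : ℝ), 0 < ε₁ → ∀ V : (famX L i).Bdry, (famX L i).Reg7 ε₁ V →
        ∀ U₀ : (famX L i).Cfg, (famX L i).InU ((L : ℝ) ^ 3 * B₃ * ε₁) U₀ → (famX L i).InB V U₀ →
          (ε₀ ≤ a₀ → B₃ * ε₁ ≤ ε₀ → (famX L i).AtMostOneCriticalOrbit ε₀ V) ∧
          (ε₁ ≤ a₁' → ∃ U : (famX L i).Cfg, (famX L i).OnMinimalOrbit (O₁ * (L : ℝ) ^ 3 * B₃ * ε₁) V U))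
    (h2 : ∀ L : ℕ, Odd L → 1 < L → Summit.QuantumFields.YangMills.Theorems.AlphaInputsT3ACv4RecChi L)
    (h3 : ∀ (L : ℕ), Odd L → 7 ≤ L → ∀ (𝔠 : AlphaConsts L (suGroupModel 2).N) (a₀ a₁ : ℝ), 0 < a₀ → 0 < a₁ → 𝔠.B₃ * a₁ ≤ a₀ →
      ∃ a : ℝ, 0 < a ∧ a < 1 ∧ K1aLegRowsRChiV4 L 𝔠 a₀ a₁ a)
    (hI : ∀ (L : ℕ), Odd L → 1 < L → L < 7 → ∀ (μ : ℝ), 0 < μ → μ < 1 → ∀ (𝔠 : AlphaConsts L (suGroupModel 2).N) (a₀ a₁ : ℝ),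
      0 < a₀ → 0 < a₁ → 𝔠.B₃ * a₁ ≤ a₀ → ∃ a : ℝ, 0 < a ∧ a < 1 ∧ K1aChartRowsOnChiChiV4 L μ 𝔠 a₀ a₁ a) :
    FluctuationComparisonRegPrIntL :=
  regPrIntL_of_v4ChiStubs Summit.QuantumFields.YangMills.Theorems.ApproxLift.AnsatzT.stub_oneStepSmallLift (thm1In8GlobalMin_of_v7Leaves hV2 hV3) h2
    (Summit.QuantumFields.YangMills.Theorems.GlobalSlackCanonicalPolymers.globalTwoRunSlackFamChiV4_of_k1aChartRowsCChiV4 fun L hLo h7 𝔠 a₀ a₁ ha0 ha1 hw => by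
      obtain ⟨a, ha, ha1', hc⟩ := h3 L hLo h7 𝔠 a₀ a₁ ha0 ha1 hw
      exact ⟨a, ha, ha1', k1aChartRowsCChiV4_of_legRowsTChiV4 (k1aLegRowsTChiV4_of_GChiV4 (k1aLegRowsGChiV4_of_RChiV4 hc))⟩)
    (Summit.QuantumFields.YangMills.Theorems.GlobalSlackCanonicalOnChi.smallBlocksSlackOnChiAllChiV4_of_k1aChartRowsOnChiChiV4 hI)

end Summit.QuantumFields.YangMills.Theorems.InteriorExcision

end
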